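import Literature.NumberTheory.DiophantineGeometry.AbcGyory2008
import Literature.NumberTheory.DiophantineGeometry.AbcStewartYu2001PlaceBoundsAnalysis
import HarnessLib

/-!
# Stewart–Yu 2001, Theorem 2, V: Vojta's `max`-sentence is Győry 2008 in print (kernel links)

`Literature/NumberTheory/DiophantineGeometry/AbcStewartYu2001GyoryProofs.lean` — proofs companion
(theorems only; no definition, no named fact) of `AbcStewartYu2001.lean` and `AbcGyory2008.lean`.

Stewart–Yu 2001, Theorem 2 is typed as `stewartYu2001_thm2` with `p′ = min{P(x), P(y), P(z)}`
([cite: Gyory2008, p. 282 (1.3)], Pasten 2024 §1 (ii), Sheppard 2016 Thm 2.4.2); P. Vojta's zbMATH review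
[cite: VojtaZbl103611032, review text] prints the WEAKER sentence
`z < exp(max{P(x), P(y), P(z)} · G^{C log₃ G⋆ / log₂ G})`. Part IV (`AbcStewartYu2001MaxFormProofs.lean`)
derived that `max`-sentence from the `p ∣ z` place bound alone and from Yu 2007 over `ℚ` alone. This part
records that the `max`-sentence is moreover a refereed theorem IN PRINT with explicit constants,
independently of the (cite-only) Duke paper: Győry, Acta Arith. 133 (2008) — typed in `AbcGyory2008.lean` —
prints for coprime positive `a + b = c`
* (Theorem 1 at `K = ℚ`, p. 287) `log c < 2²³ (P/log* P) N^{653 log₃ N⋆ / log₂ N⋆}`, `P = P(abc)`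
  (`gyory2008_thm1_rat`), and
* (Corollary (2.10), p. 284 ⇒ (3.12), p. 287) `log c < 2^{10t+22} t⁴ (P/log* P) ∏_{p ∣ abc} log p`
  (`gyory2008_cor_2_10`, `Gyory2008.eq_3_12_of_cor`),

and here we PROVE that each implies Vojta's sentence in the tree's currency
(`StewartYu2001.thm2Exponent C G = C log₃ G⋆ / log₂ G`):
* (private) `largestPrimeFactor_mul_three` — `P(xyz) = max{P(x), P(y), P(z)}`;
* `StewartYu2001.maxForm_of_gyory2008_thm1_rat` — with `C = 653 + 17 / log₃ 16` (the factor `2²³ < e¹⁷`,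
  the saving `1/log* P ≤ 1` and the denominator `log₂ N⋆ ≥ log₂ N` are absorbed: `log G ≥ log₂ G⋆` for
  `G ≥ 6`);
* `StewartYu2001.maxForm_of_gyory2008_cor_2_10` — via (3.12) and `StewartYu2001.absorb` with `K = 2¹⁰`
  (`2^{10t+22} t⁴ ∏ log p < 128 (2^{10(t+1)} ∏ log max(4,p))² t² log G ≤ G^{thm2Exponent C G}`).

So, whatever the Duke page's letter (`min` per three secondaries, `max` per the review), the `max`-sentence
attributed to [cite: StewartYu2001, Theorem 2] holds by [cite: Gyory2008, §3 Theorem 1] — in the kernel,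
modulo the ONE named fact `gyory2008_thm1_rat` (resp. `gyory2008_cor_2_10`). Nothing here bears on `abc`
itself.

## References

* [Gyory2008] K. Győry, *On the abc conjecture in algebraic number fields*, Acta Arith. 133 (2008), 281–295
  — (2.10) p. 284; Theorem 1 (3.7) p. 286; the `K = ℚ` sentence, (3.12)–(3.13) p. 287.
* [StewartYu2001] C. L. Stewart, K. Yu, *On the abc conjecture, II*, Duke Math. J. 108 (2001), 169–181 —
  Theorem 2.
* [VojtaZbl103611032] P. Vojta, zbMATH review Zbl 1036.11032 of [StewartYu2001] (the `max` sentence).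
-/

noncomputable section

open Finset Real
open Literature.Barriers.ABC

namespace Literature.NumberTheory.DiophantineGeometry

namespace StewartYu2001

open Literature.NumberTheory.DiophantineGeometry.Dioph (logStar logStar_def one_le_logStar)

/-! ### `P(xyz) = max{P(x), P(y), P(z)}` -/

/-- For positive `x, y, z`: `P(xyz) = max{P(x), P(y), P(z)}` (`P(1) = 1`). [folklore] -/
private theorem largestPrimeFactor_mul_three {x y z : ℕ} (hx : x ≠ 0) (hy : y ≠ 0) (hz : z ≠ 0) :
    largestPrimeFactor (x * y * z) =
      max (largestPrimeFactor x) (max (largestPrimeFactor y) (largestPrimeFactor z)) := by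
  have hU : (x * y * z).primeFactors = x.primeFactors ∪ y.primeFactors ∪ z.primeFactors := by
    rw [Nat.primeFactors_mul (mul_ne_zero hx hy) hz, Nat.primeFactors_mul hx hy]
  simp only [largestPrimeFactor_def]
  rw [hU]
  apply le_antisymm
  · refine max_le (le_max_of_le_left (le_max_left _ _)) (Finset.sup_le fun q hq => ?_)
    simp only [Finset.mem_union] at hq
    rcases hq with (hq | hq) | hq
    · exact le_max_of_le_left (le_max_of_le_right (Finset.le_sup (f := id) hq))
    · exact le_max_of_le_right (le_max_of_le_left (le_max_of_le_right (Finset.le_sup (f := id) hq)))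
    · exact le_max_of_le_right (le_max_of_le_right (le_max_of_le_right (Finset.le_sup (f := id) hq)))
  · refine max_le (max_le_max le_rfl (Finset.sup_mono ?_))
      (max_le (max_le_max le_rfl (Finset.sup_mono ?_)) (max_le_max le_rfl (Finset.sup_mono ?_)))
    · exact Finset.subset_union_left.trans Finset.subset_union_left
    · exact Finset.subset_union_right.trans Finset.subset_union_left
    · exact Finset.subset_union_right

/-! ### Numerical facts about the exponent -/

/-- `log₂ G⋆ ≤ log G` for `G ≥ 6` (`G⋆ = max(G, 16)`): `log 16 < 2.78 ≤ 6 ≤ G` and `log G ≤ G`.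
[folklore] -/
private theorem log_log_max_le_log {G : ℝ} (hG : 6 ≤ G) : Real.log (Real.log (max G 16)) ≤ Real.log G := by
  have hG0 : 0 < G := by linarith
  have h16 : (0 : ℝ) < max G 16 := lt_of_lt_of_le (by norm_num) (le_max_right G 16)
  have hlogpos : 0 < Real.log (max G 16) := Real.log_pos (lt_of_lt_of_le (by norm_num) (le_max_right G 16))
  apply Real.log_le_log hlogpos
  rcases le_total G 16 with h | h
  · rw [max_eq_right h]
    have h4 : Real.log 16 = 4 * Real.log 2 := by
      rw [show (16 : ℝ) = 2 ^ 4 by norm_num, Real.log_pow]; norm_num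
    rw [h4]
    have h2 := Real.log_two_lt_d9
    linarith
  · rw [max_eq_left h]
    have := Real.log_le_sub_one_of_pos hG0
    linarith

/-- `2²³ < e¹⁷`. [folklore] -/
private theorem two_pow_23_lt_exp_17 : (2 : ℝ) ^ (23 : ℕ) < Real.exp 17 := by
  have he := Real.exp_one_gt_d9
  have h1 : (2.7182818283 : ℝ) ^ (17 : ℕ) < Real.exp 1 ^ (17 : ℕ) :=
    pow_lt_pow_left₀ he (by norm_num) (by norm_num)
  have h17 : Real.exp 17 = Real.exp 1 ^ (17 : ℕ) := by rw [Real.exp_one_pow]; norm_num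
  rw [h17]
  have h2 : (2 : ℝ) ^ (23 : ℕ) < (2.7182818283 : ℝ) ^ (17 : ℕ) := by norm_num
  exact h2.trans h1

/-- The comparison of exponents: for `G ≥ 6`, with `ℓ₀ = log₃ 16`, `G⋆ = max(G, 16)` and
`C = 653 + 17/ℓ₀`, one has `2²³ · G^{653 log₃ G⋆ / log₂ G⋆} ≤ G^{thm2Exponent C G}`
(`log₂ G ≤ log₂ G⋆`, `log₃ G⋆ ≥ ℓ₀`, `log G / log₂ G⋆ ≥ 1`, `e¹⁷ > 2²³`). [folklore] -/
private theorem two_pow_mul_rpow_le_rpow_thm2Exponent {G : ℝ} (hG : 6 ≤ G) :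
    (2 : ℝ) ^ (23 : ℕ) * G ^ (653 * Real.log (Real.log (Real.log (max G 16))) / Real.log (Real.log (max G 16))) ≤
      G ^ thm2Exponent (653 + 17 / Real.log (Real.log (Real.log 16))) G := by
  set ℓ₀ : ℝ := Real.log (Real.log (Real.log 16)) with hℓ₀
  set ℓ₃ : ℝ := Real.log (Real.log (Real.log (max G 16))) with hℓ₃
  set L₂s : ℝ := Real.log (Real.log (max G 16)) with hL₂s
  set L₂ : ℝ := Real.log (Real.log G) with hL₂
  have hℓ₀pos : 0 < ℓ₀ := log_log_log_pos le_rfl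
  have hℓ₃ge : ℓ₀ ≤ ℓ₃ := by
    -- `log₃` is monotone on `[16, ∞)`
    have h16 : (16 : ℝ) ≤ max G 16 := le_max_right _ _
    have hl1 : 1 < Real.log (16 : ℝ) := by
      rw [Real.lt_log_iff_exp_lt (by norm_num)]
      have he := Real.exp_one_lt_d9; linarith
    have hll16 : 0 < Real.log (Real.log (16 : ℝ)) := Real.log_pos hl1
    exact Real.log_le_log hll16 (Real.log_le_log (by linarith) (Real.log_le_log (by norm_num) h16))
  have hℓ₃pos : 0 < ℓ₃ := lt_of_lt_of_le hℓ₀pos hℓ₃ge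
  have hL₂pos : 0 < L₂ := log_log_pos (by linarith)
  have hL₂le : L₂ ≤ L₂s := by
    have hG0 : 0 < G := by linarith
    have hlogG : 0 < Real.log G := Real.log_pos (by linarith)
    exact Real.log_le_log hlogG (Real.log_le_log hG0 (le_max_left G 16))
  have hL₂spos : 0 < L₂s := lt_of_lt_of_le hL₂pos hL₂le
  have hG1 : (1 : ℝ) ≤ G := by linarith
  have hG0 : 0 < G := by linarith
  -- Step 1: `thm2Exponent C G ≥ C ℓ₃ / L₂s = 653 ℓ₃/L₂s + (17/ℓ₀) ℓ₃ / L₂s`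
  have hC0 : 0 ≤ 653 + 17 / ℓ₀ := by positivity
  have hexp_ge : (653 + 17 / ℓ₀) * ℓ₃ / L₂s ≤ thm2Exponent (653 + 17 / ℓ₀) G := by
    rw [thm2Exponent_def]
    exact div_le_div_of_nonneg_left (by positivity) hL₂pos hL₂le
  -- Step 2: `(17/ℓ₀) ℓ₃ / L₂s ≥ 17 / L₂s` and `G^{17/L₂s} ≥ e^{17}`
  have h17 : 17 / L₂s ≤ (17 / ℓ₀) * ℓ₃ / L₂s := by
    apply div_le_div_of_nonneg_right _ hL₂spos.le
    rw [div_mul_eq_mul_div, le_div_iff₀ hℓ₀pos]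
    exact mul_le_mul_of_nonneg_left hℓ₃ge (by norm_num)
  have hlogG_ge : L₂s ≤ Real.log G := log_log_max_le_log hG
  have hpow17 : Real.exp 17 ≤ G ^ (17 / L₂s) := by
    rw [Real.rpow_def_of_pos hG0, Real.exp_le_exp]
    -- `17 ≤ log G * (17 / L₂s)` since `log G ≥ L₂s > 0`
    rw [mul_div_assoc', le_div_iff₀ hL₂spos]
    nlinarith
  -- assemble
  calc (2 : ℝ) ^ (23 : ℕ) * G ^ (653 * ℓ₃ / L₂s)
      ≤ G ^ (17 / L₂s) * G ^ (653 * ℓ₃ / L₂s) := by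
        apply mul_le_mul_of_nonneg_right _ (Real.rpow_nonneg hG0.le _)
        exact le_trans two_pow_23_lt_exp_17.le hpow17
    _ = G ^ (17 / L₂s + 653 * ℓ₃ / L₂s) := by rw [← Real.rpow_add hG0]
    _ ≤ G ^ ((653 + 17 / ℓ₀) * ℓ₃ / L₂s) := by
        apply Real.rpow_le_rpow_of_exponent_le hG1
        have : (653 + 17 / ℓ₀) * ℓ₃ / L₂s = (17 / ℓ₀) * ℓ₃ / L₂s + 653 * ℓ₃ / L₂s := by ring
        rw [this]; linarith
    _ ≤ G ^ thm2Exponent (653 + 17 / ℓ₀) G := Real.rpow_le_rpow_of_exponent_le hG1 hexp_ge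

/-! ### Vojta's `max`-sentence from Győry's Theorem 1 over `ℚ` -/

/-- **Győry 2008, Theorem 1 (`K = ℚ`) implies Vojta's `max`-sentence for Stewart–Yu 2001, Theorem 2**:
if `log c < 2²³ (P(abc)/log* P(abc)) N^{653 log₃ N⋆ / log₂ N⋆}` for all coprime positive `a + b = c`,
then there is `C > 0` (namely `653 + 17 / log₃ 16`) with
`z < exp(max{P(x), P(y), P(z)} · G^{C log₃ G⋆ / log₂ G})` for all coprime positive `x + y = z`, `z > 2`
(`P(xyz) = max P`; `1/log* P ≤ 1`; `2²³` and the denominator `log₂ N⋆ ≥ log₂ N` are absorbed into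
the constant). So the `max`-form is a theorem in print with explicit constants.
[cite: Gyory2008, §3 Theorem 1, `K = ℚ` sentence p. 287] [cite: VojtaZbl103611032, review text]
[cite: StewartYu2001, Theorem 2 (weak form)] -/
theorem maxForm_of_gyory2008_thm1_rat (hG : gyory2008_thm1_rat) :
    ∃ C : ℝ, 0 < C ∧ ∀ x y z : ℕ, IsABCTriple x y z → 2 < z →
      (z : ℝ) < Real.exp
        ((max (largestPrimeFactor x) (max (largestPrimeFactor y) (largestPrimeFactor z)) : ℕ) *
          (rad x y z : ℝ) ^ thm2Exponent C (rad x y z)) := by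
  have hℓ₀pos : 0 < Real.log (Real.log (Real.log 16)) := log_log_log_pos le_rfl
  refine ⟨653 + 17 / Real.log (Real.log (Real.log 16)), by positivity, fun x y z h hz => ?_⟩
  have hz0 : (0 : ℝ) < z := by exact_mod_cast lt_trans two_pos hz
  rw [← Real.log_lt_iff_lt_exp hz0]
  obtain ⟨hx, hy, hxyz, hcop⟩ := id h
  have h1 := hG x y z h
  have hR6 : (6 : ℝ) ≤ (rad x y z : ℝ) := by exact_mod_cast six_le_rad h hz
  have hR0 : (0 : ℝ) < (rad x y z : ℝ) := by linarith
  have hPeq : largestPrimeFactor (x * y * z) =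
      max (largestPrimeFactor x) (max (largestPrimeFactor y) (largestPrimeFactor z)) :=
    largestPrimeFactor_mul_three (by omega) (by omega) (by omega)
  set P : ℕ := largestPrimeFactor (x * y * z) with hP
  have hP0 : (0 : ℝ) ≤ P := Nat.cast_nonneg _
  -- `P / log* P ≤ P`
  have hfrac : (P : ℝ) / logStar P ≤ P := by
    calc (P : ℝ) / logStar P ≤ (P : ℝ) / 1 := div_le_div_of_nonneg_left hP0 one_pos (one_le_logStar _)
      _ = P := div_one _
  have hpow0 : 0 ≤ (rad x y z : ℝ) ^ (653 * Real.log (Real.log (Real.log (max (rad x y z : ℝ) 16))) /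
      Real.log (Real.log (max (rad x y z : ℝ) 16))) := Real.rpow_nonneg hR0.le _
  rw [← hPeq]
  calc Real.log z
      < (2 : ℝ) ^ (23 : ℕ) * ((P : ℝ) / logStar P) *
          (rad x y z : ℝ) ^ (653 * Real.log (Real.log (Real.log (max (rad x y z : ℝ) 16))) /
            Real.log (Real.log (max (rad x y z : ℝ) 16))) := h1
    _ ≤ (2 : ℝ) ^ (23 : ℕ) * P *
          (rad x y z : ℝ) ^ (653 * Real.log (Real.log (Real.log (max (rad x y z : ℝ) 16))) /
            Real.log (Real.log (max (rad x y z : ℝ) 16))) := by gcongr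
    _ = P * ((2 : ℝ) ^ (23 : ℕ) *
          (rad x y z : ℝ) ^ (653 * Real.log (Real.log (Real.log (max (rad x y z : ℝ) 16))) /
            Real.log (Real.log (max (rad x y z : ℝ) 16)))) := by ring
    _ ≤ P * (rad x y z : ℝ) ^ thm2Exponent (653 + 17 / Real.log (Real.log (Real.log 16))) (rad x y z) :=
        mul_le_mul_of_nonneg_left (two_pow_mul_rpow_le_rpow_thm2Exponent hR6) hP0

/-! ### Vojta's `max`-sentence from Győry's Corollary (2.10), via (3.12) and `absorb` -/

/-- `∏_{p ∣ n} log p ≤ ∏_{p ∣ n} log max(4, p)` and the left product is positive. [folklore] -/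
private theorem prod_log_le_prod_log_max_four {S : Finset ℕ} (hS : ∀ q ∈ S, q.Prime) :
    0 < ∏ q ∈ S, Real.log (q : ℝ) ∧
      ∏ q ∈ S, Real.log (q : ℝ) ≤ ∏ q ∈ S, Real.log ((max 4 q : ℕ) : ℝ) := by
  refine ⟨Finset.prod_pos fun q hq => Real.log_pos (by exact_mod_cast (hS q hq).one_lt), ?_⟩
  apply Finset.prod_le_prod
  · exact fun q hq => (Real.log_pos (by exact_mod_cast (hS q hq).one_lt)).le
  · intro q hq
    exact Real.log_le_log (by exact_mod_cast (hS q hq).pos) (by exact_mod_cast le_max_right 4 q)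

/-- **Győry's Corollary (2.10) implies Vojta's `max`-sentence**: from (3.12),
`log c ≤ 2^{10t+22} t⁴ (P/log* P) ∏_{p ∣ abc} log p ≤ P(abc) · [2^{10t+22} t⁴ ∏ log p]`, and the
bracket is `< G^{C log₃ G⋆ / log₂ G}` by `StewartYu2001.absorb` (with `K = 2¹⁰`:
`2^{10t+22} t⁴ Π < 128 (2^{10(t+1)} Π₄)² t² log G`, `Π = ∏ log p ≤ Π₄ = ∏ log max(4, p)`). [cite: Gyory2008, §2 Corollary (2.10) and p. 287 (3.12)]
[cite: VojtaZbl103611032, review text] [cite: StewartYu2001, Theorem 2 (weak form)] -/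
theorem maxForm_of_gyory2008_cor_2_10 (hG : gyory2008_cor_2_10) :
    ∃ C : ℝ, 0 < C ∧ ∀ x y z : ℕ, IsABCTriple x y z → 2 < z →
      (z : ℝ) < Real.exp
        ((max (largestPrimeFactor x) (max (largestPrimeFactor y) (largestPrimeFactor z)) : ℕ) *
          (rad x y z : ℝ) ^ thm2Exponent C (rad x y z)) := by
  obtain ⟨C, hC, habs⟩ := absorb (show (1 : ℝ) ≤ 2 ^ (10 : ℕ) by norm_num)
  refine ⟨C, hC, fun x y z h hz => ?_⟩
  have hz0 : (0 : ℝ) < z := by exact_mod_cast lt_trans two_pos hz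
  rw [← Real.log_lt_iff_lt_exp hz0]
  obtain ⟨hx, hy, hxyz, hcop⟩ := id h
  have h312 := Gyory2008.eq_3_12_of_cor hG h
  have hz' : 0 < z := by omega
  have h0 : x * y * z ≠ 0 := by positivity
  set S := (x * y * z).primeFactors with hSdef
  set t : ℕ := S.card with ht
  have hS : ∀ q ∈ S, q.Prime := fun q hq => Nat.prime_of_mem_primeFactors hq
  have hrad : ((rad x y z : ℕ) : ℝ) = ∏ q ∈ S, (q : ℝ) := by
    rw [rad_def, Nat.radical_eq_prod_primeFactors]; push_cast; rfl
  have hR6 : (6 : ℝ) ≤ (rad x y z : ℝ) := by exact_mod_cast six_le_rad h hz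
  have h6 : (6 : ℝ) ≤ ∏ q ∈ S, (q : ℝ) := hrad ▸ hR6
  have habsS := habs S hS h6
  rw [← hrad] at habsS
  have hPeq : largestPrimeFactor (x * y * z) =
      max (largestPrimeFactor x) (max (largestPrimeFactor y) (largestPrimeFactor z)) :=
    largestPrimeFactor_mul_three (by omega) (by omega) (by omega)
  set P : ℕ := largestPrimeFactor (x * y * z) with hP
  have hP1 : (1 : ℝ) ≤ P := by exact_mod_cast one_le_largestPrimeFactor (x * y * z)
  have hP0 : (0 : ℝ) ≤ P := by linarith
  obtain ⟨hPlpos, hPlle⟩ := prod_log_le_prod_log_max_four hS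
  set Pl : ℝ := ∏ q ∈ S, Real.log (q : ℝ) with hPl
  set Pl4 : ℝ := ∏ q ∈ S, Real.log ((max 4 q : ℕ) : ℝ) with hPl4
  have hPl4ge : Pl ≤ Pl4 := hPlle
  have hPl4pos : 0 < Pl4 := lt_of_lt_of_le hPlpos hPl4ge
  have htR : (1 : ℝ) ≤ t := by
    have hS0 : S.Nonempty := by
      rw [hSdef, Nat.nonempty_primeFactors]
      have hab : 1 ≤ x * y := Nat.one_le_iff_ne_zero.mpr (by positivity)
      have := Nat.mul_le_mul hab (show 2 ≤ z by omega)
      omega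
    exact_mod_cast Finset.card_pos.mpr hS0
  have hlogG : 1 < Real.log (rad x y z : ℕ) := by
    have : Real.exp 1 < (rad x y z : ℝ) := by have he := Real.exp_one_lt_d9; linarith
    have hr0 : (0 : ℝ) < rad x y z := by linarith
    rwa [Real.lt_log_iff_exp_lt hr0]
  -- the bracket `B = 2^{10t+22} t⁴ Pl` and its absorption
  set B : ℝ := (2 : ℝ) ^ (10 * t + 22) * (t : ℝ) ^ 4 * Pl with hB
  -- `t² ≤ 4^t` (from `t ≤ 2^t`)
  have ht2 : (t : ℝ) ^ 2 ≤ (4 : ℝ) ^ t := by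
    have h1 : (t : ℝ) ≤ (2 : ℝ) ^ t := by exact_mod_cast Nat.lt_two_pow_self.le
    have h0t : (0 : ℝ) ≤ t := Nat.cast_nonneg _
    calc (t : ℝ) ^ 2 ≤ ((2 : ℝ) ^ t) ^ 2 := pow_le_pow_left₀ h0t h1 2
      _ = (4 : ℝ) ^ t := by rw [← pow_mul, mul_comm, pow_mul]; norm_num
  have h4 : (4 : ℝ) ^ t = (2 : ℝ) ^ (2 * t) := by rw [pow_mul]; norm_num
  -- `B ≤ 2^{12t+22} t² Pl4`
  have hB1 : B ≤ (2 : ℝ) ^ (12 * t + 22) * (t : ℝ) ^ 2 * Pl4 := by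
    have hstep : (2 : ℝ) ^ (10 * t + 22) * ((t : ℝ) ^ 2 * (t : ℝ) ^ 2) * Pl ≤
        (2 : ℝ) ^ (10 * t + 22) * ((t : ℝ) ^ 2 * (4 : ℝ) ^ t) * Pl4 :=
      mul_le_mul (mul_le_mul_of_nonneg_left (mul_le_mul_of_nonneg_left ht2 (by positivity))
        (by positivity)) hPl4ge hPlpos.le (by positivity)
    calc B = (2 : ℝ) ^ (10 * t + 22) * ((t : ℝ) ^ 2 * (t : ℝ) ^ 2) * Pl := by rw [hB]; ring
      _ ≤ (2 : ℝ) ^ (10 * t + 22) * ((t : ℝ) ^ 2 * (4 : ℝ) ^ t) * Pl4 := hstep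
      _ = (2 : ℝ) ^ (12 * t + 22) * (t : ℝ) ^ 2 * Pl4 := by
          rw [h4, show 12 * t + 22 = 10 * t + 22 + 2 * t by ring, pow_add]; ring
  -- `2^{12t+22} t² Pl4 < 128 (2^{10(t+1)} Pl4)² t² log G = 2^{20t+27} t² Pl4 (Pl4 log G)`
  have h128 : (128 : ℝ) * ((((2 : ℝ) ^ (10 : ℕ)) ^ (t + 1)) ^ 2) = (2 : ℝ) ^ (20 * t + 27) := by
    rw [← pow_mul, ← pow_mul, show (128 : ℝ) = 2 ^ 7 by norm_num, ← pow_add]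
    congr 1; ring
  have hPl41 : 1 ≤ Pl4 := one_le_prod_log_max_four S
  have hPl4log : 1 < Pl4 * Real.log (rad x y z : ℕ) := by nlinarith
  have hkey : (2 : ℝ) ^ (12 * t + 22) * (t : ℝ) ^ 2 * Pl4 <
      128 * ((((2 : ℝ) ^ (10 : ℕ)) ^ (t + 1)) * Pl4) ^ 2 * (t : ℝ) ^ 2 * Real.log (rad x y z : ℕ) := by
    have hrhs : 128 * ((((2 : ℝ) ^ (10 : ℕ)) ^ (t + 1)) * Pl4) ^ 2 * (t : ℝ) ^ 2 *
        Real.log (rad x y z : ℕ) =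
        (2 : ℝ) ^ (20 * t + 27) * (t : ℝ) ^ 2 * Pl4 * (Pl4 * Real.log (rad x y z : ℕ)) := by
      rw [← h128]; ring
    rw [hrhs]
    have hpow_lt : (2 : ℝ) ^ (12 * t + 22) < (2 : ℝ) ^ (20 * t + 27) :=
      pow_lt_pow_right₀ (by norm_num) (by omega)
    have ht2pos : 0 < (t : ℝ) ^ 2 := by positivity
    calc (2 : ℝ) ^ (12 * t + 22) * (t : ℝ) ^ 2 * Pl4
        = (2 : ℝ) ^ (12 * t + 22) * (t : ℝ) ^ 2 * Pl4 * 1 := by ring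
      _ < (2 : ℝ) ^ (12 * t + 22) * (t : ℝ) ^ 2 * Pl4 * (Pl4 * Real.log (rad x y z : ℕ)) :=
          mul_lt_mul_of_pos_left hPl4log (by positivity)
      _ < (2 : ℝ) ^ (20 * t + 27) * (t : ℝ) ^ 2 * Pl4 * (Pl4 * Real.log (rad x y z : ℕ)) := by
          have hpos : 0 < (t : ℝ) ^ 2 * Pl4 * (Pl4 * Real.log (rad x y z : ℕ)) := by positivity
          nlinarith
  have hBabs : B < (rad x y z : ℝ) ^ thm2Exponent C (rad x y z) :=
    lt_of_lt_of_le (lt_of_le_of_lt hB1 hkey) habsS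
  -- conclude
  rw [← hPeq]
  have hfrac : (P : ℝ) / logStar P ≤ P := by
    calc (P : ℝ) / logStar P ≤ (P : ℝ) / 1 := div_le_div_of_nonneg_left hP0 one_pos (one_le_logStar _)
      _ = P := div_one _
  calc Real.log z ≤ (2 : ℝ) ^ (10 * t + 22) * (t : ℝ) ^ 4 * ((P : ℝ) / logStar P) * Pl := h312
    _ ≤ (2 : ℝ) ^ (10 * t + 22) * (t : ℝ) ^ 4 * P * Pl := by gcongr
    _ = P * B := by rw [hB]; ring
    _ < P * (rad x y z : ℝ) ^ thm2Exponent C (rad x y z) :=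
        mul_lt_mul_of_pos_left hBabs (by linarith)

end StewartYu2001

end Literature.NumberTheory.DiophantineGeometry
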